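import Literature.Analysis.FunctionSpaces.TorusSpaceTime
import Literature.Analysis.FunctionSpaces.TorusTestFunction
import Literature.Analysis.FunctionSpaces.TorusDerivBounds
import Mathlib.Analysis.Calculus.ContDiff.Bounds
import HarnessLib

/-!
# Joint continuity of the space derivatives of a time-dependent field from joint continuity of the
# field and time-uniform bounds on its higher space derivatives (Landau interpolation on `T^d`)

Analysis/FunctionSpaces proof file (theorems only; no definitions, no named facts). For a field
`φ : ℝ × T^d → F` on a time set `S` with
(i) space–time lift continuous on `S × ℝ^d` (`ContinuousOn (stLift φ) (S ×ˢ univ)`),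
(ii) every slice `φ t`, `t ∈ S`, smooth in space (`Torus.IsSmooth`), and
(iii) for every order `n` a bound `‖Dⁿ(lift (φ t))(y)‖ ≤ C_n` uniform in `t ∈ S`, `y ∈ ℝ^d`,
ALL iterated space derivatives `∂^l φ` are again jointly continuous on `S × T^d` (and satisfy (ii), (iii)):
`Torus.continuousOn_stLift_iterPartialDeriv`. The mechanism is the elementary Landau-type interpolation
bound `‖∂ⱼu‖_∞ ≤ 2‖u‖_∞/h + h·sup‖D²(lift u)‖` (`h > 0`; mean value inequality,
`Torus.norm_partialDeriv_le_of_norm_le`), applied to `u = φ s − φ t`, together with the tube lemma over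
the compact torus (`Torus.eventually_norm_sub_lt_of_continuousOn`).

This is the regularity upgrade that turns the qualitative clauses of a Lagrangian carrier's level /
flow package (`LagrangianLatticeCarrier.LevelRegular`: joint continuity + smooth slices + window-uniform
derivative bounds) into the joint continuity of all space derivatives consumed by the distorted weak
class test hypotheses (frame-regularity package FR2 of the cell `ad-ideate`).

## References

* E. Landau, *Einige Ungleichungen für zweimal differentiierbare Funktionen*, Proc. LMS (2) 13 (1913)
  43–49 (`|f′| ≤ 2(M₀M₂)^{1/2}`; here in the non-optimised form `2M₀/h + M₂h`). [`Landau1913`]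
* L. C. Evans, *Partial Differential Equations*, 2nd ed., AMS 2010, §5.8 / App. C (interpolation and
  mean value inequalities). [`Evans2010`]
-/

noncomputable section

open Set Filter Topology Function
open scoped ContDiff

namespace Literature.Analysis.FunctionSpaces

namespace Torus

variable {d : Type*} [Fintype d] [DecidableEq d]
variable {F : Type*} [NormedAddCommGroup F] [NormedSpace ℝ F]

/-! ## §1 The Landau-type bound on `ℝ^d` and on the torus -/

omit [DecidableEq d] in
/-- **Landau-type interpolation bound** (mean value inequality form): for `g : ℝ^d → F` of class `C²`
with `‖g‖ ≤ M₀` and `‖D²g‖ ≤ M₂` everywhere, `h > 0` and a unit vector `e`,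
`‖Dg(y) e‖ ≤ 2M₀/h + M₂ h`. [cite: Landau1913, Satz 1 (non-optimised form)] -/
theorem norm_fderiv_apply_le_of_norm_le {E' : Type*} [NormedAddCommGroup E'] [NormedSpace ℝ E']
    {g : E' → F} (hg : ContDiff ℝ 2 g) {M₀ M₂ : ℝ} (h0 : ∀ z, ‖g z‖ ≤ M₀)
    (h2 : ∀ z, ‖iteratedFDeriv ℝ 2 g z‖ ≤ M₂) {h : ℝ} (hh : 0 < h) (y e : E') (he : ‖e‖ = 1) :
    ‖_root_.fderiv ℝ g y e‖ ≤ 2 * M₀ / h + M₂ * h := by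
  have hM₂ : 0 ≤ M₂ := (norm_nonneg _).trans (h2 y)
  have hd1 : Differentiable ℝ g := hg.differentiable (by norm_num)
  have hd2 : Differentiable ℝ (_root_.fderiv ℝ g) :=
    (hg.fderiv_right (m := 1) (by norm_num)).differentiable (by norm_num)
  -- `‖D(Dg)(z)‖ ≤ M₂`
  have hDD : ∀ z, ‖_root_.fderiv ℝ (_root_.fderiv ℝ g) z‖ ≤ M₂ := by
    intro z
    refine ContinuousLinearMap.opNorm_le_bound _ hM₂ fun a => ?_
    refine ContinuousLinearMap.opNorm_le_bound _ (by positivity) fun b => ?_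
    have e2 := iteratedFDeriv_two_apply (𝕜 := ℝ) g z ![a, b]
    simp only [Matrix.cons_val_zero, Matrix.cons_val_one] at e2
    rw [← e2]
    calc ‖iteratedFDeriv ℝ 2 g z ![a, b]‖ ≤ ‖iteratedFDeriv ℝ 2 g z‖ * ∏ i, ‖(![a, b] : Fin 2 → E') i‖ :=
          ContinuousMultilinearMap.le_opNorm _ _
      _ = ‖iteratedFDeriv ℝ 2 g z‖ * (‖a‖ * ‖b‖) := by simp [Fin.prod_univ_two]
      _ ≤ M₂ * (‖a‖ * ‖b‖) := mul_le_mul_of_nonneg_right (h2 z) (by positivity)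
      _ = M₂ * ‖a‖ * ‖b‖ := by ring
  -- `Dg` is `M₂`-Lipschitz
  have hLip : ∀ z w, ‖_root_.fderiv ℝ g z - _root_.fderiv ℝ g w‖ ≤ M₂ * ‖z - w‖ := fun z w =>
    Convex.norm_image_sub_le_of_norm_fderiv_le (s := univ) (fun x _ => hd2.differentiableAt)
      (fun x _ => hDD x) convex_univ (mem_univ _) (mem_univ _)
  -- second-order Taylor estimate on the ball of radius `h` around `y`
  have htaylor : ‖g (y + h • e) - g y - _root_.fderiv ℝ g y ((y + h • e) - y)‖ ≤ M₂ * h * ‖(y + h • e) - y‖ := by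
    refine Convex.norm_image_sub_le_of_norm_hasFDerivWithin_le' (s := Metric.closedBall y h)
      (f' := fun z => _root_.fderiv ℝ g z) (fun z _ => (hd1 z).hasFDerivAt.hasFDerivWithinAt) (fun z hz => ?_)
      (convex_closedBall y h) (Metric.mem_closedBall_self hh.le) ?_
    · calc ‖_root_.fderiv ℝ g z - _root_.fderiv ℝ g y‖ ≤ M₂ * ‖z - y‖ := hLip z y
        _ ≤ M₂ * h := mul_le_mul_of_nonneg_left (by rwa [Metric.mem_closedBall, dist_eq_norm] at hz) hM₂
    · rw [Metric.mem_closedBall, dist_eq_norm, add_sub_cancel_left, norm_smul, Real.norm_eq_abs,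
        abs_of_pos hh, he, mul_one]
  rw [add_sub_cancel_left, norm_smul, Real.norm_eq_abs, abs_of_pos hh, he, mul_one, map_smul] at htaylor
  have hmain : h * ‖_root_.fderiv ℝ g y e‖ ≤ 2 * M₀ + M₂ * h * h := by
    have e1 : ‖h • _root_.fderiv ℝ g y e‖ = h * ‖_root_.fderiv ℝ g y e‖ := by
      rw [norm_smul, Real.norm_eq_abs, abs_of_pos hh]
    rw [← e1]
    calc ‖h • _root_.fderiv ℝ g y e‖
        = ‖(g (y + h • e) - g y) - (g (y + h • e) - g y - h • _root_.fderiv ℝ g y e)‖ := by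
          congr 1; abel
      _ ≤ ‖g (y + h • e) - g y‖ + ‖g (y + h • e) - g y - h • _root_.fderiv ℝ g y e‖ := norm_sub_le _ _
      _ ≤ (‖g (y + h • e)‖ + ‖g y‖) + M₂ * h * h := add_le_add (norm_sub_le _ _) htaylor
      _ ≤ (M₀ + M₀) + M₂ * h * h := by gcongr <;> exact h0 _
      _ = 2 * M₀ + M₂ * h * h := by ring
  rw [div_add' _ _ _ hh.ne', le_div_iff₀ hh]
  calc ‖_root_.fderiv ℝ g y e‖ * h = h * ‖_root_.fderiv ℝ g y e‖ := mul_comm _ _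
    _ ≤ 2 * M₀ + M₂ * h * h := hmain

/-- **Landau-type bound on the torus**: for smooth `u : T^d → F` with `‖u‖ ≤ M₀` and
`‖D²(lift u)‖ ≤ M₂`, and `h > 0`: `‖∂ⱼu(x)‖ ≤ 2M₀/h + M₂ h`. [cite: Landau1913, Satz 1 (non-optimised form)] -/
theorem norm_partialDeriv_le_of_norm_le {u : UnitAddTorus d → F} (hu : IsSmooth u) {M₀ M₂ : ℝ}
    (h0 : ∀ x, ‖u x‖ ≤ M₀) (h2 : ∀ y, ‖iteratedFDeriv ℝ 2 (lift u) y‖ ≤ M₂) {h : ℝ} (hh : 0 < h)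
    (j : d) (x : UnitAddTorus d) : ‖partialDeriv j u x‖ ≤ 2 * M₀ / h + M₂ * h := by
  obtain ⟨y, rfl⟩ := proj_surjective x
  have h1 : IsContDiff 1 u := hu.isContDiff (by simp)
  have hcd : ContDiff ℝ 2 (lift u) := hu.isContDiff (n := 2) (by decide)
  have e1 : partialDeriv j u (proj y) = _root_.fderiv ℝ (lift u) y (EuclideanSpace.single j (1 : ℝ)) := by
    have := congrFun (lift_lineDeriv h1 (EuclideanSpace.single j (1 : ℝ))) y
    exact this
  rw [e1]
  exact norm_fderiv_apply_le_of_norm_le hcd (fun z => h0 (proj z)) h2 hh y _ (by simp)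

/-! ## §2 One space derivative: joint continuity from (i)–(iii) -/

/-- The derivative bounds shift by one order under a partial derivative:
`‖Dⁿ(lift ∂ⱼu)‖ ≤ ‖Dⁿ⁺¹(lift u)‖`. [folklore] -/
private theorem norm_iteratedFDeriv_lift_partialDeriv_le {u : UnitAddTorus d → F} (hu : IsSmooth u) (j : d)
    (n : ℕ) (y : EuclideanSpace ℝ d) :
    ‖iteratedFDeriv ℝ n (lift (partialDeriv j u)) y‖ ≤ ‖iteratedFDeriv ℝ (n + 1) (lift u) y‖ := by
  have h1 : IsContDiff 1 u := hu.isContDiff (by simp)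
  have hl : lift (partialDeriv j u) = fun y => _root_.fderiv ℝ (lift u) y (EuclideanSpace.single j (1 : ℝ)) :=
    lift_lineDeriv h1 _
  rw [hl]
  have hD : ContDiff ℝ n (_root_.fderiv ℝ (lift u)) := hu.fderiv_right (m := n) (by exact_mod_cast le_top)
  calc ‖iteratedFDeriv ℝ n (fun y => _root_.fderiv ℝ (lift u) y (EuclideanSpace.single j (1 : ℝ))) y‖
      ≤ ‖(EuclideanSpace.single j (1 : ℝ) : EuclideanSpace ℝ d)‖ * ‖iteratedFDeriv ℝ n (_root_.fderiv ℝ (lift u)) y‖ :=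
        norm_iteratedFDeriv_clm_apply_const hD.contDiffAt (by exact_mod_cast le_rfl)
    _ = ‖iteratedFDeriv ℝ (n + 1) (lift u) y‖ := by
        rw [show ‖(EuclideanSpace.single j (1 : ℝ) : EuclideanSpace ℝ d)‖ = 1 by simp, one_mul,
          norm_iteratedFDeriv_fderiv]

variable {φ : ℝ → UnitAddTorus d → F} {S : Set ℝ}

/-- **Joint continuity of one space derivative.** If the space–time lift of `φ` is continuous on
`S × ℝ^d`, every slice `φ t` (`t ∈ S`) is smooth, and `‖D²(lift (φ t))‖ ≤ M₂` uniformly in `t ∈ S`,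
then the space–time lift of `∂ⱼφ` is continuous on `S × ℝ^d`. [cite: Landau1913, Satz 1 (application)] -/
theorem continuousOn_stLift_partialDeriv (hc : ContinuousOn (stLift φ) (S ×ˢ univ))
    (hs : ∀ t ∈ S, IsSmooth (φ t)) {M₂ : ℝ} (hM : ∀ t ∈ S, ∀ y, ‖iteratedFDeriv ℝ 2 (lift (φ t)) y‖ ≤ M₂)
    (j : d) : ContinuousOn (stLift fun t => partialDeriv j (φ t)) (S ×ˢ univ) := by
  rintro ⟨t₀, y₀⟩ hp
  have ht₀ : t₀ ∈ S := (mem_prod.1 hp).1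
  have hM₀ : 0 ≤ M₂ := (norm_nonneg _).trans (hM t₀ ht₀ y₀)
  refine Metric.tendsto_nhds.2 fun ε hε => ?_
  -- parameters
  set h : ℝ := ε / (8 * (M₂ + 1)) with hh_def
  have hh : 0 < h := by positivity
  set η : ℝ := ε * h / 16 with hη_def
  have hη : 0 < η := by positivity
  -- (a) uniform-in-space closeness of the slices near `t₀`
  have hev1 : ∀ᶠ p in 𝓝[S ×ˢ univ] ((t₀, y₀) : ℝ × EuclideanSpace ℝ d),
      (∀ x, ‖φ p.1 x - φ t₀ x‖ < η) ∧ p.1 ∈ S := by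
    have h1 : ∀ᶠ s in 𝓝[S] t₀, (∀ x, ‖φ s x - φ t₀ x‖ < η) ∧ s ∈ S :=
      (eventually_norm_sub_lt_of_continuousOn hc ht₀ hη).and eventually_mem_nhdsWithin
    rw [nhdsWithin_prod_eq]
    exact h1.prod_inl _
  -- (b) continuity of the smooth slice derivative `∂ⱼφ t₀` at `y₀`
  have hev2 : ∀ᶠ p in 𝓝[S ×ˢ univ] ((t₀, y₀) : ℝ × EuclideanSpace ℝ d),
      ‖partialDeriv j (φ t₀) (proj p.2) - partialDeriv j (φ t₀) (proj y₀)‖ < ε / 2 := by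
    have hcont : Continuous (lift (partialDeriv j (φ t₀))) := by
      have h : ContDiff ℝ ∞ (lift (partialDeriv j (φ t₀))) := (hs t₀ ht₀).partialDeriv j
      exact h.continuous
    have h1 : ∀ᶠ y in 𝓝 y₀, ‖partialDeriv j (φ t₀) (proj y) - partialDeriv j (φ t₀) (proj y₀)‖ < ε / 2 := by
      have := Metric.tendsto_nhds.1 (hcont.tendsto y₀) (ε / 2) (half_pos hε)
      filter_upwards [this] with y hy
      rwa [dist_eq_norm] at hy
    rw [nhdsWithin_prod_eq, nhdsWithin_univ]
    exact h1.prod_inr _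
  filter_upwards [hev1, hev2] with p hp1 hp2
  obtain ⟨s, y⟩ := p
  obtain ⟨hclose, hsS⟩ := hp1
  simp only at hclose hsS hp2
  rw [dist_eq_norm]
  show ‖partialDeriv j (φ s) (proj y) - partialDeriv j (φ t₀) (proj y₀)‖ < ε
  -- the Landau bound for the difference slice `φ s − φ t₀`
  have hdiff : ‖partialDeriv j (fun x => φ s x - φ t₀ x) (proj y)‖ ≤ 2 * η / h + (M₂ + M₂) * h := by
    refine norm_partialDeriv_le_of_norm_le ((hs s hsS).sub (hs t₀ ht₀)) (fun x => (hclose x).le)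
      (fun z => ?_) hh j (proj y)
    have hcs : ContDiff ℝ 2 (lift (φ s)) := (hs s hsS).isContDiff (n := 2) (by decide)
    have hct : ContDiff ℝ 2 (lift (φ t₀)) := (hs t₀ ht₀).isContDiff (n := 2) (by decide)
    show ‖iteratedFDeriv ℝ 2 (lift (φ s) - lift (φ t₀)) z‖ ≤ M₂ + M₂
    rw [iteratedFDeriv_sub_apply hcs.contDiffAt hct.contDiffAt]
    exact (norm_sub_le _ _).trans (add_le_add (hM s hsS z) (hM t₀ ht₀ z))
  have hsub : partialDeriv j (fun x => φ s x - φ t₀ x) (proj y) =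
      partialDeriv j (φ s) (proj y) - partialDeriv j (φ t₀) (proj y) := by
    have h1s : IsContDiff 1 (φ s) := (hs s hsS).isContDiff (by simp)
    have h1t : IsContDiff 1 (φ t₀) := (hs t₀ ht₀).isContDiff (by simp)
    have h1d : IsContDiff 1 (fun x => φ s x - φ t₀ x) := h1s.sub h1t
    have hds : Differentiable ℝ (lift (φ s)) := by
      have h : ContDiff ℝ ∞ (lift (φ s)) := hs s hsS
      exact h.differentiable (by simp)
    have hdt : Differentiable ℝ (lift (φ t₀)) := by
      have h : ContDiff ℝ ∞ (lift (φ t₀)) := hs t₀ ht₀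
      exact h.differentiable (by simp)
    rw [show partialDeriv j (fun x => φ s x - φ t₀ x) (proj y) =
        _root_.fderiv ℝ (lift fun x => φ s x - φ t₀ x) y (EuclideanSpace.single j (1 : ℝ)) from
        congrFun (lift_lineDeriv h1d _) y,
      show partialDeriv j (φ s) (proj y) = _root_.fderiv ℝ (lift (φ s)) y (EuclideanSpace.single j (1 : ℝ)) from
        congrFun (lift_lineDeriv h1s _) y,
      show partialDeriv j (φ t₀) (proj y) = _root_.fderiv ℝ (lift (φ t₀)) y (EuclideanSpace.single j (1 : ℝ)) from
        congrFun (lift_lineDeriv h1t _) y,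
      show lift (fun x => φ s x - φ t₀ x) = lift (φ s) - lift (φ t₀) from rfl,
      fderiv_sub hds.differentiableAt hdt.differentiableAt, FunLike.coe_sub, Pi.sub_apply]
  -- numerics: `2η/h = ε/8`, `2M₂h ≤ ε/4`
  have hnum1 : 2 * η / h = ε / 8 := by
    rw [hη_def]; field_simp; ring
  have hnum2 : (M₂ + M₂) * h ≤ ε / 4 := by
    rw [hh_def]
    rw [show (M₂ + M₂) * (ε / (8 * (M₂ + 1))) = ε / 4 * (M₂ / (M₂ + 1)) by field_simp; ring]
    have : M₂ / (M₂ + 1) ≤ 1 := by rw [div_le_one (by positivity)]; linarith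
    calc ε / 4 * (M₂ / (M₂ + 1)) ≤ ε / 4 * 1 := by gcongr
      _ = ε / 4 := mul_one _
  calc ‖partialDeriv j (φ s) (proj y) - partialDeriv j (φ t₀) (proj y₀)‖
      = ‖(partialDeriv j (φ s) (proj y) - partialDeriv j (φ t₀) (proj y)) +
          (partialDeriv j (φ t₀) (proj y) - partialDeriv j (φ t₀) (proj y₀))‖ := by congr 1; abel
    _ ≤ ‖partialDeriv j (φ s) (proj y) - partialDeriv j (φ t₀) (proj y)‖ +
          ‖partialDeriv j (φ t₀) (proj y) - partialDeriv j (φ t₀) (proj y₀)‖ := norm_add_le _ _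
    _ < (2 * η / h + (M₂ + M₂) * h) + ε / 2 := by
        refine add_lt_add_of_le_of_lt ?_ hp2
        rw [← hsub]; exact hdiff
    _ ≤ ε / 8 + ε / 4 + ε / 2 := by rw [hnum1]; linarith
    _ < ε := by linarith

/-! ## §3 All orders -/

/-- **Joint continuity of all space derivatives** (induction on the word): under (i) continuity of the
space–time lift on `S × ℝ^d`, (ii) smooth slices on `S`, (iii) order-by-order bounds on `Dⁿ(lift (φ t))`
uniform in `t ∈ S`, every iterated space derivative `∂^l φ` again satisfies (i) and (iii) (and (ii)).
[cite: Landau1913, Satz 1 (application, all orders)] -/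
theorem continuousOn_stLift_iterPartialDeriv_and_bounds (hc : ContinuousOn (stLift φ) (S ×ˢ univ))
    (hs : ∀ t ∈ S, IsSmooth (φ t))
    (hB : ∀ n : ℕ, ∃ C : ℝ, ∀ t ∈ S, ∀ y, ‖iteratedFDeriv ℝ n (lift (φ t)) y‖ ≤ C) :
    ∀ l : List d,
      ContinuousOn (stLift fun t => iterPartialDeriv l (φ t)) (S ×ˢ univ) ∧
        ∀ n : ℕ, ∃ C : ℝ, ∀ t ∈ S, ∀ y, ‖iteratedFDeriv ℝ n (lift (iterPartialDeriv l (φ t))) y‖ ≤ C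
  | [] => ⟨hc, hB⟩
  | j :: l => by
    obtain ⟨hcl, hBl⟩ := continuousOn_stLift_iterPartialDeriv_and_bounds hc hs hB l
    have hsl : ∀ t ∈ S, IsSmooth (iterPartialDeriv l (φ t)) := fun t ht => (hs t ht).iterPartialDeriv l
    refine ⟨?_, fun n => ?_⟩
    · obtain ⟨M₂, hM₂⟩ := hBl 2
      have h := continuousOn_stLift_partialDeriv (φ := fun t => iterPartialDeriv l (φ t)) hcl hsl hM₂ j
      simpa [iterPartialDeriv_cons] using h
    · obtain ⟨C, hC⟩ := hBl (n + 1)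
      refine ⟨C, fun t ht y => ?_⟩
      rw [iterPartialDeriv_cons]
      exact (norm_iteratedFDeriv_lift_partialDeriv_le (hsl t ht) j n y).trans (hC t ht y)

/-- **Joint continuity of all space derivatives** — the continuity clause alone.
[cite: Landau1913, Satz 1 (application, all orders)] -/
theorem continuousOn_stLift_iterPartialDeriv (hc : ContinuousOn (stLift φ) (S ×ˢ univ))
    (hs : ∀ t ∈ S, IsSmooth (φ t))
    (hB : ∀ n : ℕ, ∃ C : ℝ, ∀ t ∈ S, ∀ y, ‖iteratedFDeriv ℝ n (lift (φ t)) y‖ ≤ C) (l : List d) :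
    ContinuousOn (stLift fun t => iterPartialDeriv l (φ t)) (S ×ˢ univ) :=
  (continuousOn_stLift_iterPartialDeriv_and_bounds hc hs hB l).1

/-- **Time-uniform bounds of all space derivatives, word form**: `‖∂^l φ(t, x)‖ ≤ C_{|l|}` on `S`.
[cite: Landau1913, Satz 1 (application, all orders)] -/
theorem exists_norm_iterPartialDeriv_le (hs : ∀ t ∈ S, IsSmooth (φ t))
    (hB : ∀ n : ℕ, ∃ C : ℝ, ∀ t ∈ S, ∀ y, ‖iteratedFDeriv ℝ n (lift (φ t)) y‖ ≤ C) (l : List d) :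
    ∃ C : ℝ, ∀ t ∈ S, ∀ x, ‖iterPartialDeriv l (φ t) x‖ ≤ C := by
  -- the bounds clause of the induction does not use continuity; run it with `S`-slices only
  have key : ∀ l : List d, ∀ n : ℕ, ∃ C : ℝ, ∀ t ∈ S, ∀ y,
      ‖iteratedFDeriv ℝ n (lift (iterPartialDeriv l (φ t))) y‖ ≤ C := by
    intro l
    induction l with
    | nil => simpa using hB
    | cons j l ih =>
      intro n
      obtain ⟨C, hC⟩ := ih (n + 1)
      refine ⟨C, fun t ht y => ?_⟩
      rw [iterPartialDeriv_cons]
      exact (norm_iteratedFDeriv_lift_partialDeriv_le ((hs t ht).iterPartialDeriv l) j n y).trans (hC t ht y)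
  obtain ⟨C, hC⟩ := key l 0
  refine ⟨C, fun t ht x => ?_⟩
  obtain ⟨y, rfl⟩ := proj_surjective x
  have := hC t ht y
  rwa [norm_iteratedFDeriv_zero] at this

/-- **Global-in-time form**: if (i)–(iii) hold on all of `ℝ`, every `∂^l φ` is jointly continuous on
`ℝ × T^d` as an uncurried map (the hypothesis shape of the cell's space–time test classes).
[cite: Landau1913, Satz 1 (application, all orders)] -/
theorem continuous_uncurry_iterPartialDeriv (hc : Continuous (stLift φ)) (hs : ∀ t, IsSmooth (φ t))
    (hB : ∀ n : ℕ, ∃ C : ℝ, ∀ t y, ‖iteratedFDeriv ℝ n (lift (φ t)) y‖ ≤ C) (l : List d) :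
    Continuous (uncurry fun t x => iterPartialDeriv l (φ t) x) := by
  have h := continuousOn_stLift_iterPartialDeriv (S := univ) (by rw [univ_prod_univ]; exact hc.continuousOn)
    (fun t _ => hs t) (fun n => by obtain ⟨C, hC⟩ := hB n; exact ⟨C, fun t _ y => hC t y⟩) l
  rw [univ_prod_univ, continuousOn_univ] at h
  exact continuous_uncurry_of_continuous_stLift h

end Torus

end Literature.Analysis.FunctionSpaces

end
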